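import Summits.CriticalPhenomena.CardyFormulaZ2.Theorems.CardyBoundaryCoulombGasBoundaryDefectGaussianRStubRigidityOfLocalLawsPart2

/-!
# Stub `stub_rigidity_of_local_laws` of line `rainbow-monomials-in-excursion-kernels` — Part 8:
# abstract rigidity, V2 (cluster locality with connectivity hypotheses + hole-freeness)

Crux `BoundaryDefectGaussianR` (stmt-CriticalPhenomena-14132). The registered CLUSTER_LOCALITY text
was refuted by the stub-2 worker (a far hole / a far king-diagonal component of the complement
changes the collar model), and corrected to CLV2: the same law under four extra hypotheses — `V`
lattice-connected, `ℤ² ∖ V` king-connected, and the same for `V′`. Correspondingly the lattice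
approximations of a rectilinear Jordan domain must EVENTUALLY have these two properties
(HOLEFREE). `s3_rigidityAbstractV2` is `s3_rigidityAbstract` (Part 2) with two abstract predicates
`C1, C2 : Finset (ℤ × ℤ) → Prop`, the abstract HOLEFREE `∀ D, Rect D → … → LA D δ V → ∀ᶠ n,
C1 (V n) ∧ C2 (V n)` as a new hypothesis, and `C1 V → C2 V → C1 V' → C2 V' →` inserted in the
cluster-locality hypothesis after `1 ≤ m →`; the proof is unchanged except that the two HOLEFREE
eventualities (for `D` and `D′`) are intersected with the others before cluster locality is invoked
at `V_n, V′_n`. Part 9 instantiates it: `s3_rigidityOfTransportV2 : TRANSPORT → HOLEFREE → REAL →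
POINT_TRANSPORT → CLV2 → RIGIDITY`.

Also here (registered sub-goal `s3_latticeStep_kingStep`): a lattice step is a king step — the
elementary relation between the two adjacency predicates of CLV2/HOLEFREE.
-/

noncomputable section

open Filter Topology

namespace Summit.CriticalPhenomena.CardyFormulaZ2.Cruxes.BoundaryDefectGaussianR.RainbowMonomialsInExcursionKernels

/-- **Rigidity from the local laws, abstract form, V2** (cluster locality under connectivity
hypotheses `C1 V, C2 V, C1 V', C2 V'`, supplied eventually along lattice approximations by the
abstract hole-freeness hypothesis). See Part 2 for the V1 statement and the proof outline; only the
intersection with the two hole-freeness eventualities is new. [folklore] -/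
theorem s3_rigidityAbstractV2 :
    ∀ {k : ℕ} (Adm : Finset (ℤ × ℤ) → (Fin k → ℤ × ℤ) → Prop) (P F : Finset (ℤ × ℤ) → (Fin k → ℤ × ℤ) → ℝ)
    (Rect : Literature.Probability.RandomPlanarGeometry.JordanDomain → Prop) (FM OR :
    Literature.Probability.RandomPlanarGeometry.MarkedDomain k → Prop) (LA :
    Literature.Probability.RandomPlanarGeometry.JordanDomain → (ℕ → ℝ) → (ℕ → Finset (ℤ × ℤ)) → Prop) (CV :
    Literature.Probability.RandomPlanarGeometry.MarkedDomain k → (ℕ → ℝ) → (ℕ → Fin k → ℤ × ℤ) → Prop) (C1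
    C2 : Finset (ℤ × ℤ) → Prop), (∀ (D : Literature.Probability.RandomPlanarGeometry.MarkedDomain k), Rect
    D.toJordanDomain → FM D → OR D → ∀ (δ : ℕ → ℝ), (∀ n, 0 < δ n) → Filter.Tendsto δ Filter.atTop (nhds 0)
    → ∀ (V : ℕ → Finset (ℤ × ℤ)), LA D.toJordanDomain δ V → ∀ (p : ℕ → Fin k → ℤ × ℤ), (∀ n,
    Function.Injective ((p) n)) → CV D δ p → (∀ n, Adm (V n) (p n)) → ∃ (a : ℕ → ℤ × ℤ) (s₀ r₀ : ℝ) (N : ℕ),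
    0 < s₀ ∧ 0 < r₀ ∧ (∀ᶠ n in Filter.atTop, ∀ v : ℤ × ℤ, (((((v).1 - (a n).1) ^ 2 + ((v).2 - (a n).2) ^ 2 :
    ℤ) : ℝ)) ≤ (s₀ / δ n) ^ 2 → (v ∈ V n ↔ 0 ≤ v.2 - (a n).2)) ∧ ∀ r : ℝ, 0 < r → r ≤ r₀ → ∀ ρ : ℝ, 0 < ρ →
    ρ ≤ r → ∀ᶠ n in Filter.atTop, ∀ x : Fin k → ℤ, StrictMono x → (∀ i₁ i₂ : Fin k, i₁ ≠ i₂ → (r / δ n) ^ 2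
    ≤ (((x i₁ - x i₂) ^ 2 : ℤ) : ℝ)) → (∀ i, (((x i) ^ 2 : ℤ) : ℝ) ≤ (s₀ / δ n) ^ 2) → ∃ (T : ℕ) (q : ℕ →
    Fin k → ℤ × ℤ) (σ : ℕ → Bool), q 0 = p n ∧ (q T = fun i ↦ ((a n).1 + x i, (a n).2)) ∧ (T : ℝ) * δ n ≤ N
    ∧ ((Finset.range T).filter (fun t ↦ σ t = false)).card ≤ N ∧ (∀ t, t ≤ T → Function.Injective (q t) ∧
    Adm (V n) (q t) ∧ (∀ i, ∃ d : ℤ × ℤ, (d = (1, 0) ∨ d = (-1, 0) ∨ d = (0, 1) ∨ d = (0, -1)) ∧ ∀ v : ℤ ×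
    ℤ, (((((v).1 - (q t i).1) ^ 2 + ((v).2 - (q t i).2) ^ 2 : ℤ) : ℝ)) ≤ (ρ / 4 / δ n) ^ 2 → (v ∈ V n ↔ 0 ≤
    (v.1 - (q t i).1) * d.1 + (v.2 - (q t i).2) * d.2)) ∧ (∀ i₁ i₂ : Fin k, i₁ ≠ i₂ → (r / δ n) ^ 2 ≤
    ((((((q t) i₁).1 - ((q t) i₂).1) ^ 2 + (((q t) i₁).2 - ((q t) i₂).2) ^ 2 : ℤ) : ℝ)))) ∧ (∀ t, t < T → (σ
    t = true → ∃ (i : Fin k) (τ : ℤ × ℤ), (τ = (1, 0) ∨ τ = (-1, 0) ∨ τ = (0, 1) ∨ τ = (0, -1)) ∧ q (t + 1)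
    = Function.update (q t) i (q t i + τ)) ∧ (σ t = false → ∃ (i : Fin k) (q' : ℤ × ℤ), q (t + 1) =
    Function.update (q t) i q' ∧ (∀ i', i' ≠ i → ∃ d : ℤ × ℤ, (d = (1, 0) ∨ d = (-1, 0) ∨ d = (0, 1) ∨ d =
    (0, -1)) ∧ ∀ v : ℤ × ℤ, (((((v).1 - (q t i').1) ^ 2 + ((v).2 - (q t i').2) ^ 2 : ℤ) : ℝ)) ≤ (r / δ n) ^
    2 → (v ∈ V n ↔ 0 ≤ (v.1 - (q t i').1) * d.1 + (v.2 - (q t i').2) * d.2)) ∧ (((((q').1 - (q t i).1) ^ 2 +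
    ((q').2 - (q t i).2) ^ 2 : ℤ) : ℝ)) ≤ (ρ / δ n) ^ 2))) → (∀ (D :
    Literature.Probability.RandomPlanarGeometry.JordanDomain), Rect D → ∀ (δ : ℕ → ℝ), (∀ n, 0 < δ n) →
    Filter.Tendsto δ Filter.atTop (nhds 0) → ∀ (V : ℕ → Finset (ℤ × ℤ)), LA D δ V → ∀ᶠ n in Filter.atTop, C1
    (V n) ∧ C2 (V n)) → (∀ (D : Literature.Probability.RandomPlanarGeometry.JordanDomain), Rect D → ∀ (r :
    ℝ), 0 < r → ∀ (δ : ℕ → ℝ), (∀ n, 0 < δ n) → Filter.Tendsto δ Filter.atTop (nhds 0) → ∀ (V : ℕ → Finset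
    (ℤ × ℤ)), LA D δ V → ∀ᶠ n in Filter.atTop, ∀ (p : Fin k → ℤ × ℤ), Function.Injective p → Adm (V n) p →
    (∀ i', ∃ d : ℤ × ℤ, (d = (1, 0) ∨ d = (-1, 0) ∨ d = (0, 1) ∨ d = (0, -1)) ∧ ∀ v : ℤ × ℤ, (((((v).1 - (p
    i').1) ^ 2 + ((v).2 - (p i').2) ^ 2 : ℤ) : ℝ)) ≤ (r / δ n) ^ 2 → (v ∈ V n ↔ 0 ≤ (v.1 - (p i').1) * d.1 +
    (v.2 - (p i').2) * d.2)) → (∀ i₁ i₂ : Fin k, i₁ ≠ i₂ → (r / δ n) ^ 2 ≤ ((((((p) i₁).1 - ((p) i₂).1) ^ 2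
    + (((p) i₁).2 - ((p) i₂).2) ^ 2 : ℤ) : ℝ))) → 0 < P (V n) p) → ((∀ (D :
    Literature.Probability.RandomPlanarGeometry.JordanDomain), Rect D → ∀ (r ε : ℝ), 0 < r → 0 < ε → ∀ (δ :
    ℕ → ℝ), (∀ n, 0 < δ n) → Filter.Tendsto δ Filter.atTop (nhds 0) → ∀ (V : ℕ → Finset (ℤ × ℤ)), LA D δ V →
    ∀ᶠ n in Filter.atTop, ∀ (p : Fin k → ℤ × ℤ) (i : Fin k) (τ : ℤ × ℤ), (τ = (1, 0) ∨ τ = (-1, 0) ∨ τ = (0,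
    1) ∨ τ = (0, -1)) → Function.Injective p → Function.Injective (Function.update p i (p i + τ)) → Adm (V
    n) p → Adm (V n) (Function.update p i (p i + τ)) → 0 < P (V n) p → 0 < P (V n) (Function.update p i (p i
    + τ)) → (∀ i', ∃ d : ℤ × ℤ, (d = (1, 0) ∨ d = (-1, 0) ∨ d = (0, 1) ∨ d = (0, -1)) ∧ ∀ v : ℤ × ℤ,
    (((((v).1 - (p i').1) ^ 2 + ((v).2 - (p i').2) ^ 2 : ℤ) : ℝ)) ≤ (r / δ n) ^ 2 → (v ∈ V n ↔ 0 ≤ (v.1 - (p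
    i').1) * d.1 + (v.2 - (p i').2) * d.2)) → (∀ i₁ i₂ : Fin k, i₁ ≠ i₂ → (r / δ n) ^ 2 ≤ ((((((p) i₁).1 -
    ((p) i₂).1) ^ 2 + (((p) i₁).2 - ((p) i₂).2) ^ 2 : ℤ) : ℝ))) → |F (V n) (Function.update p i (p i + τ)) -
    F (V n) p| ≤ ε * δ n) ∧ (∀ (D : Literature.Probability.RandomPlanarGeometry.JordanDomain), Rect D → ∀ (r
    ε : ℝ), 0 < r → 0 < ε → ∃ ρ : ℝ, 0 < ρ ∧ ρ ≤ r ∧ ∀ (δ : ℕ → ℝ), (∀ n, 0 < δ n) → Filter.Tendsto δ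
    Filter.atTop (nhds 0) → ∀ (V : ℕ → Finset (ℤ × ℤ)), LA D δ V → ∀ᶠ n in Filter.atTop, ∀ (p : Fin k → ℤ ×
    ℤ) (i : Fin k) (q : ℤ × ℤ), Function.Injective p → Function.Injective (Function.update p i q) → Adm (V
    n) p → Adm (V n) (Function.update p i q) → 0 < P (V n) p → 0 < P (V n) (Function.update p i q) → (∀ i',
    i' ≠ i → ∃ d : ℤ × ℤ, (d = (1, 0) ∨ d = (-1, 0) ∨ d = (0, 1) ∨ d = (0, -1)) ∧ ∀ v : ℤ × ℤ, (((((v).1 -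
    (p i').1) ^ 2 + ((v).2 - (p i').2) ^ 2 : ℤ) : ℝ)) ≤ (r / δ n) ^ 2 → (v ∈ V n ↔ 0 ≤ (v.1 - (p i').1) *
    d.1 + (v.2 - (p i').2) * d.2)) → (∃ d : ℤ × ℤ, (d = (1, 0) ∨ d = (-1, 0) ∨ d = (0, 1) ∨ d = (0, -1)) ∧ ∀
    v : ℤ × ℤ, (((((v).1 - (p i).1) ^ 2 + ((v).2 - (p i).2) ^ 2 : ℤ) : ℝ)) ≤ (ρ / 4 / δ n) ^ 2 → (v ∈ V n ↔
    0 ≤ (v.1 - (p i).1) * d.1 + (v.2 - (p i).2) * d.2)) → (∃ d : ℤ × ℤ, (d = (1, 0) ∨ d = (-1, 0) ∨ d = (0,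
    1) ∨ d = (0, -1)) ∧ ∀ v : ℤ × ℤ, (((((v).1 - (q).1) ^ 2 + ((v).2 - (q).2) ^ 2 : ℤ) : ℝ)) ≤ (ρ / 4 / δ n)
    ^ 2 → (v ∈ V n ↔ 0 ≤ (v.1 - (q).1) * d.1 + (v.2 - (q).2) * d.2)) → (∀ i₁ i₂ : Fin k, i₁ ≠ i₂ → (r / δ n)
    ^ 2 ≤ ((((((p) i₁).1 - ((p) i₂).1) ^ 2 + (((p) i₁).2 - ((p) i₂).2) ^ 2 : ℤ) : ℝ))) → (∀ i₁ i₂ : Fin k,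
    i₁ ≠ i₂ → (r / δ n) ^ 2 ≤ (((((((Function.update p i q)) i₁).1 - (((Function.update p i q)) i₂).1) ^ 2 +
    ((((Function.update p i q)) i₁).2 - (((Function.update p i q)) i₂).2) ^ 2 : ℤ) : ℝ))) → (((((q).1 - (p
    i).1) ^ 2 + ((q).2 - (p i).2) ^ 2 : ℤ) : ℝ)) ≤ (ρ / δ n) ^ 2 → |F (V n) (Function.update p i q) - F (V
    n) p| ≤ ε)) → (∀ ε : ℝ, 0 < ε → ∃ M : ℝ, 0 < M ∧ ∀ (V V' : Finset (ℤ × ℤ)) (a a' : ℤ × ℤ) (m : ℝ), 1 ≤ m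
    → C1 V → C2 V → C1 V' → C2 V' → (∀ v : ℤ × ℤ, (((((v).1 - (a).1) ^ 2 + ((v).2 - (a).2) ^ 2 : ℤ) : ℝ)) ≤
    (M * m) ^ 2 → (v ∈ V ↔ 0 ≤ v.2 - (a).2)) → (∀ v : ℤ × ℤ, (((((v).1 - (a').1) ^ 2 + ((v).2 - (a').2) ^ 2
    : ℤ) : ℝ)) ≤ (M * m) ^ 2 → (v ∈ V' ↔ 0 ≤ v.2 - (a').2)) → ∀ (p : Fin k → ℤ × ℤ), Function.Injective p →
    (∀ i, (((((p i).1 - (a).1) ^ 2 + ((p i).2 - (a).2) ^ 2 : ℤ) : ℝ)) ≤ m ^ 2) → Adm V p → Adm V' (fun i ↦ p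
    i - a + a') → 0 < P V p → 0 < P V' (fun i ↦ p i - a + a') → |F V p - F V' (fun i ↦ p i - a + a')| ≤ ε) →
    ∀ (D D' : Literature.Probability.RandomPlanarGeometry.MarkedDomain k), Rect D.toJordanDomain → FM D → OR
    D → Rect D'.toJordanDomain → FM D' → OR D' → ∀ (δ : ℕ → ℝ), (∀ n, 0 < δ n) → Filter.Tendsto δ
    Filter.atTop (nhds 0) → ∀ (V V' : ℕ → Finset (ℤ × ℤ)), LA D.toJordanDomain δ V → LA D'.toJordanDomain δ
    V' → ∀ (p p' : ℕ → Fin k → ℤ × ℤ), (∀ n, Function.Injective ((p) n)) → (∀ n, Function.Injective ((p')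
    n)) → CV D δ p → CV D' δ p' → (∀ n, Adm (V n) (p n)) → (∀ n, Adm (V' n) (p' n)) → (∀ᶠ n in Filter.atTop,
    0 < P (V n) (p n)) ∧ Filter.Tendsto (fun n ↦ F (V n) (p n) - F (V' n) (p' n)) Filter.atTop (nhds 0) := by
  intro k Adm P F Rect FM OR LA CV C1 C2 hT hHF hR hPT hCL D D' hDre hDfm hDor hD're hD'fm hD'or δ hδ hδ0
    V V' hV hV' p p' hpinj hp'inj hpcv hp'cv hpadm hp'adm
  obtain ⟨a, s₀, r₀, N, hs₀, hr₀, hanc, hTD⟩ :=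
    hT D hDre hDfm hDor δ hδ hδ0 V hV p hpinj hpcv hpadm
  obtain ⟨a', s₀', r₀', N', hs₀', hr₀', hanc', hTD'⟩ :=
    hT D' hD're hD'fm hD'or δ hδ hδ0 V' hV' p' hp'inj hp'cv hp'adm
  have hone := s3_oneDomain Adm P F δ hδ V p a s₀ r₀ N
    (fun r ε hr hε ↦ hPT.1 D.toJordanDomain hDre r ε hr hε δ hδ hδ0 V hV)
    (fun r ε hr hε ↦ by
      obtain ⟨ρ, hρ, hρr, h⟩ := hPT.2 D.toJordanDomain hDre r ε hr hε
      exact ⟨ρ, hρ, hρr, h δ hδ hδ0 V hV⟩)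
    (fun r hr ↦ hR D.toJordanDomain hDre r hr δ hδ hδ0 V hV) hTD
  have hone' := s3_oneDomain Adm P F δ hδ V' p' a' s₀' r₀' N'
    (fun r ε hr hε ↦ hPT.1 D'.toJordanDomain hD're r ε hr hε δ hδ hδ0 V' hV')
    (fun r ε hr hε ↦ by
      obtain ⟨ρ, hρ, hρr, h⟩ := hPT.2 D'.toJordanDomain hD're r ε hr hε
      exact ⟨ρ, hρ, hρr, h δ hδ hδ0 V' hV'⟩)
    (fun r hr ↦ hR D'.toJordanDomain hD're r hr δ hδ hδ0 V' hV') hTD'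
  constructor
  · -- eventual positivity of `p n`: one-domain estimate at any admissible scale
    set r : ℝ := min r₀ (s₀ / (2 * k + 2)) with hr
    have hrpos : 0 < r := lt_min hr₀ (by positivity)
    have hrr₀ : r ≤ r₀ := min_le_left _ _
    have hrs : r * (2 * k + 2) ≤ s₀ := by
      have : r ≤ s₀ / (2 * k + 2) := min_le_right _ _
      rwa [le_div_iff₀ (by positivity)] at this
    filter_upwards [hone 1 one_pos r hrpos hrr₀, s3_slots k δ hδ hδ0 r s₀ hrpos hrs] with n hn hx
    obtain ⟨x, hx1, hx2, hx3⟩ := hx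
    exact (hn x hx1 hx2 hx3).2.1
  · rw [Metric.tendsto_nhds]
    intro ε hε
    have hε4 : 0 < ε / 4 := by positivity
    obtain ⟨M, hM, hCLM⟩ := hCL (ε / 4) hε4
    set s : ℝ := min s₀ s₀' / (M + 1) with hs
    have hspos : 0 < s := by positivity
    have hsM : M * s ≤ min s₀ s₀' := by
      rw [hs, mul_div_assoc']
      rw [div_le_iff₀ (by positivity)]
      nlinarith [le_min hs₀.le hs₀'.le, min_le_left s₀ s₀']
    set r : ℝ := min (min r₀ r₀') (s / (2 * k + 2)) with hr
    have hrpos : 0 < r := lt_min (lt_min hr₀ hr₀') (by positivity)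
    have hrr₀ : r ≤ r₀ := (min_le_left _ _).trans (min_le_left _ _)
    have hrr₀' : r ≤ r₀' := (min_le_left _ _).trans (min_le_right _ _)
    have hrs : r * (2 * k + 2) ≤ s := by
      have : r ≤ s / (2 * k + 2) := min_le_right _ _
      rwa [le_div_iff₀ (by positivity)] at this
    filter_upwards [hone (ε / 4) hε4 r hrpos hrr₀, hone' (ε / 4) hε4 r hrpos hrr₀',
      s3_slots k δ hδ hδ0 r s hrpos hrs, hanc, hanc', hδ0.eventually (eventually_le_nhds hspos),
      hHF D.toJordanDomain hDre δ hδ hδ0 V hV, hHF D'.toJordanDomain hD're δ hδ hδ0 V' hV']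
      with n hn hn' hx hancn hancn' hδs hcn hcn'
    obtain ⟨x, hx1, hx2, hx3⟩ := hx
    have hδn := hδ n
    have hss₀ : s ≤ s₀ := by
      have h1 : s ≤ min s₀ s₀' := by
        rw [hs, div_le_iff₀ (by positivity)]
        nlinarith [le_min hs₀.le hs₀'.le]
      exact h1.trans (min_le_left _ _)
    have hss₀' : s ≤ s₀' := by
      have h1 : s ≤ min s₀ s₀' := by
        rw [hs, div_le_iff₀ (by positivity)]
        nlinarith [le_min hs₀.le hs₀'.le]
      exact h1.trans (min_le_right _ _)
    have hx3₀ : ∀ i, (((x i) ^ 2 : ℤ) : ℝ) ≤ (s₀ / δ n) ^ 2 := fun i ↦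
      (hx3 i).trans (pow_le_pow_left₀ (by positivity) (div_le_div_of_nonneg_right hss₀ hδn.le) 2)
    have hx3₀' : ∀ i, (((x i) ^ 2 : ℤ) : ℝ) ≤ (s₀' / δ n) ^ 2 := fun i ↦
      (hx3 i).trans (pow_le_pow_left₀ (by positivity) (div_le_div_of_nonneg_right hss₀' hδn.le) 2)
    obtain ⟨hadmc, -, hposc, hFc⟩ := hn x hx1 hx2 hx3₀
    obtain ⟨hadmc', -, hposc', hFc'⟩ := hn' x hx1 hx2 hx3₀'
    -- cluster locality between the two clusters
    set m : ℝ := s / δ n with hm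
    have hm1 : 1 ≤ m := (one_le_div hδn).2 hδs
    have hMm : (M * m) ^ 2 ≤ (s₀ / δ n) ^ 2 := by
      apply pow_le_pow_left₀ (by positivity)
      rw [hm, mul_div_assoc']
      exact div_le_div_of_nonneg_right (hsM.trans (min_le_left _ _)) hδn.le
    have hMm' : (M * m) ^ 2 ≤ (s₀' / δ n) ^ 2 := by
      apply pow_le_pow_left₀ (by positivity)
      rw [hm, mul_div_assoc']
      exact div_le_div_of_nonneg_right (hsM.trans (min_le_right _ _)) hδn.le
    have htrans : (fun i ↦ ((a n).1 + x i, (a n).2) - a n + a' n) =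
        fun i ↦ ((a' n).1 + x i, (a' n).2) := by
      funext i
      ext
      · simp only [Prod.fst_add, Prod.fst_sub]
        ring
      · simp only [Prod.snd_add, Prod.snd_sub]
        ring
    have hinjc : Function.Injective (fun i ↦ ((a n).1 + x i, (a n).2)) := by
      intro i₁ i₂ h
      have h1 : (a n).1 + x i₁ = (a n).1 + x i₂ := congrArg Prod.fst h
      exact hx1.injective (by linarith)
    have hCLn := hCLM (V n) (V' n) (a n) (a' n) m hm1 hcn.1 hcn.2 hcn'.1 hcn'.2
      (fun v hv ↦ hancn v (hv.trans hMm)) (fun v hv ↦ hancn' v (hv.trans hMm'))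
      (fun i ↦ ((a n).1 + x i, (a n).2)) hinjc
      (fun i ↦ by
        have := hx3 i
        push_cast at this ⊢
        rw [hm]
        nlinarith [this])
      hadmc (htrans ▸ hadmc') hposc (htrans ▸ hposc')
    rw [htrans] at hCLn
    rw [Real.dist_eq, sub_zero]
    have h3 : |F (V n) (p n) - F (V' n) (p' n)| ≤
        |F (V n) (p n) - F (V n) (fun i ↦ ((a n).1 + x i, (a n).2))| +
        |F (V n) (fun i ↦ ((a n).1 + x i, (a n).2)) - F (V' n) (fun i ↦ ((a' n).1 + x i, (a' n).2))| +
        |F (V' n) (fun i ↦ ((a' n).1 + x i, (a' n).2)) - F (V' n) (p' n)| := by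
      have h1 := abs_sub_le (F (V n) (p n)) (F (V n) (fun i ↦ ((a n).1 + x i, (a n).2)))
        (F (V' n) (p' n))
      have h2 := abs_sub_le (F (V n) (fun i ↦ ((a n).1 + x i, (a n).2)))
        (F (V' n) (fun i ↦ ((a' n).1 + x i, (a' n).2))) (F (V' n) (p' n))
      linarith
    rw [abs_sub_comm] at hFc'
    linarith

/-- **A lattice step is a king step**: `(b₁-c₁)² + (b₂-c₂)² = 1` implies `max |b₁-c₁| |b₂-c₂| ≤ 1`
(the lattice adjacency of CLV2's connectivity hypothesis on `V` refines the king adjacency used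
for `ℤ² ∖ V`). [folklore] -/
theorem s3_latticeStep_kingStep :
    ∀ (b c : ℤ × ℤ), (b.1 - c.1) ^ 2 + (b.2 - c.2) ^ 2 = 1 → max |b.1 - c.1| |b.2 - c.2| ≤ 1 := by
  intro b c h
  have h1 : (b.1 - c.1) ^ 2 ≤ 1 := by nlinarith [sq_nonneg (b.2 - c.2)]
  have h2 : (b.2 - c.2) ^ 2 ≤ 1 := by nlinarith [sq_nonneg (b.1 - c.1)]
  have ha : |b.1 - c.1| ≤ 1 := by
    rw [abs_le]; constructor <;> nlinarith
  have hb : |b.2 - c.2| ≤ 1 := by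
    rw [abs_le]; constructor <;> nlinarith
  exact max_le ha hb

end Summit.CriticalPhenomena.CardyFormulaZ2.Cruxes.BoundaryDefectGaussianR.RainbowMonomialsInExcursionKernels

end
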